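import Summits.QuantumFields.YangMills.Theorems.BalabanUVNodesN15TwoGridGluingGeneralTransport
import Summits.QuantumFields.YangMills.Theorems.BalabanUVNodesN15TwoSpacingGluingGradientGluing
import HarnessLib

/-!
# N15 = NE2, road (c) — PROGRAMME (PC), (PC-E-J) GROUNDWORK FOR THE GRADIENT ENTRIES: THE TWO-GRID η-DEFECT OF `D∘𝒢` (a left factor in front of the glued random walk)
# THROUGH A GENERAL TRANSPORT `τ` — dag-n15-c g16 FILE 136 `hasMaj_idef_comp_glued_of_cutRows_defect` RE-DERIVED with King's block pull-back `pull π` replaced by an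
# ARBITRARY linear transport `τ : (X → ℝ) →ₗ (X′ → ℝ)` and the three partition fits `|h′ − h∘π| ≤ o`, `|h^s′ − h^s∘π| ≤ o_s`, `|dh′ − dh∘π| ≤ o_d` replaced by the displayed
# partition-defect ROWS `𝔇_τ(M_{h′}, M_h) ≤ diag o`, `𝔇_τ(M_{h^s′}, M_{h^s}) ≤ diag o_s`, `𝔇_τ(M_{dh′}, M_{dh}) ≤ diag o_d` (dag-n15-c g35, n15-c∕399)

Cell `pub-ymgap`, seat `pub-ymgap-dag-n15-c` (generation g35; R134 (a) seat, strategy s1 «first missing estimate»; HUMAN RULING D-0062; chair R424 venue).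
`bears_on: R4∕N15 · K3⁸ SpineGivenEndpointR13SepCoPHV (stmt-QuantumFields-27366)`; filed `--kind proof --supports stmt-QuantumFields-27366 --as helper` — COUNT-NEUTRAL.
THREE theorems, 0 `def`, 0 `sorry`; [folklore] block-norm bookkeeping.  Imports BY NAME n15-c∕332 `…TwoGridGluingGeneralTransport` (`idef_sandwich_tr`, `idef_fsum_tr`,
`hasMaj_idef_glueInv_tr`, `hasMaj_idef_remainderD_tr`) and dag-n15-c g16 FILE 136 `…TwoSpacingGluingGradientGluing` (`comp_glueInv`; through it FILE 47 `…TwoSpacingGluingEntries`: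
`comp_parametrix_of_leibniz`, `hasMaj_comp_parametrix`, `parametrix_cut`, and dag-n15-w3 `hasMaj_remainderD`).  Nothing in the tree is modified, no landed name re-declared.

WHY (the located burden after n15-c∕398).  `ne2PlusOperator_pc₀₃` has ENTRIES 0 AND 3 of (3.42) constructed for THE named scalar covariant Green's function family and ENTRIES 1–2
(`∇_UG′`, `G′∇*_U`) DISPLAYED: their two-grid η-defects on the per-cube class are the JET EDITIONS of the (PC-E) glue — and the (PC-E) glue runs through the COVARIANT transport
`τ_{Ad∘U′}` (n15-c∕331–339), not through `pull π`.  FILE 136 is the jet skeleton for `pull π`; THIS file is the same skeleton for any `τ`, i.e. the top of the entry-1 chain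
(successor: the per-cube twisted jet rows in cube gauges — `D_U∘M_{Wᵀ} = M_{Wᵀ}∘D_{U^w}`, `D_{U^w} = ∂ + M_a∘S` — feed `hIDGc` below through n15-c∕333's per-piece conversion).

CONTENTS.
* §1 `hasMaj_idef_sandwich_loc_tr` — Leibniz for the η-defect of a sandwich `M_{a′}T′M_{b′}` vs `M_aTM_b` through `τ`, the coefficient defects as ROWS (FILE 47 `hasMaj_idef_sandwich_loc`
  with `pull π ↦ τ`).
* §2 `hasMaj_idef_comp_parametrix_tr` — the η-defect of the LEFT-DRESSED parametrix `D∘G₀` through `τ` (FILE 47 `hasMaj_idef_comp_parametrix` with `pull π ↦ τ`):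
  `𝔇_τ(D′∘G₀′, D∘G₀) ≤ N_ov·[(c_sβ₁o + c_sm₁ + o_sβ₁) + (c_dβo + c_dm₀ + o_dβ)]·e^{−δd}`.
* §3 ★★★ `hasMaj_idef_comp_glued_of_cutRows_defect_tr` — FILE 136 ★★★ with `pull π ↦ τ`: `𝔇_τ(D′∘𝒢′, D∘𝒢) ≤ [A·(1−θc_r)⁻²r̂c_r³ + m̂(1−θc_r)⁻¹c_r]·e^{−(δ−2σ)d}`,
  `A = N_ov(c_sβ₁ + c_dβ)`, `θ = N_ov(θ₀+ε)`, `r̂ = N_ov(θ₀o + r + (εo + r_E))`, `m̂ = N_ov[(c_sβ₁o + c_sm₁ + o_sβ₁) + (c_dβo + c_dm₀ + o_dβ)]` — SAME constants as FILE 136.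

HONEST FRAMING ∕ LIMITS.  Generic bookkeeping over abstract block geometries; no carrier, no propagator, nothing of [B6]∕[B9] asserted; the per-cube jet rows `hIGc`, `hIDGc`, `hDK`, `hDE`
and the partition-defect rows are HYPOTHESES (their (PC-E) producers are the successor's object).  NE2⁺ NOT PRINTED ∕ NOT proved; N15 of record untouched (DISCHARGED AS CONSUMED,
p687738); K3⁸ OPEN; counts of record UNMOVED (typed 28∕28 · discharged 8∕27); one finite 𝕋⁴ at fixed ε per index — NOT infinite volume, NOT OS on ℝ⁴, NOT a mass gap, NOT Clay.
Restate-immune (no Theses import).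
-/

noncomputable section
open scoped BigOperators
open Finset

namespace Summit.QuantumFields.YangMills.BalabanUVNodes.N15.Gluing

open Literature.MathematicalPhysics.QuantumFieldTheory.Balaban1983to89
open Literature.MathematicalPhysics.QuantumFieldTheory.Balaban1983to89.B11SectG (BlockNorm HasMaj RowSum hasMaj_comp hasMaj_comp_exp)
open Literature.MathematicalPhysics.QuantumFieldTheory.Balaban1983to89.T4EtaRateDefect (idef idef_apply idef_comp idef_add idef_sub idef_inv)
open Literature.MathematicalPhysics.QuantumFieldTheory.Balaban1983to89.T4EtaRateCoeffDefect (pull pull_apply diagK diagK_nonneg hasMaj_mulOp)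
open Literature.MathematicalPhysics.QuantumFieldTheory.Balaban1983to89.B6RandomWalk (Triangle254)
open Literature.MathematicalPhysics.QuantumFieldTheory.Balaban1983to89.B6Prop26Gluing (mulOp mulOp_apply ind ind_nonneg ind_le_one)
open Summit.QuantumFields.YangMills.BalabanUVNodes.N15.CurvedSpecies (hasMaj_defectSum hasMaj_remainderD)

/-! ## §1 Leibniz for the η-defect of a sandwich through a general transport -/

section Sandwich

variable {X X' : Type} [Fintype X] [Fintype X'] {ι : Type} [Fintype ι] {g : B6.Geometry} (blk : X → g.Site) (π : X' → X) (S : ι → Set g.Site)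
  (τ : (X → ℝ) →ₗ[ℝ] (X' → ℝ))

/-- **LEIBNIZ FOR THE η-DEFECT OF A SANDWICH THROUGH `τ`**: fine letters `|a′| ≤ c_a`, coarse `|b| ≤ c_b`, coefficient-defect ROWS `𝔇_τ(M_{a′}, M_a) ≤ diag o_a`, `𝔇_τ(M_{b′}, M_b) ≤ diag o_b` (any `o_b`),
cube letters `T ≤ 1_S1_S·βe^{−δd}` (coarse), `T′ ≤ 1_S1_S·βe^{−δd}` (fine), `𝔇_τ(T′,T) ≤ 1_S1_S·me^{−δd}` ⟹ `𝔇_τ(M_{a′}T′M_{b′}, M_aTM_b) ≤ 1_S1_S·(c_aβo_b + c_amc_b + o_aβc_b)·e^{−δd}`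
(FILE 47 `hasMaj_idef_sandwich_loc` with `pull π ↦ τ`). [folklore] -/
theorem hasMaj_idef_sandwich_loc_tr {T : (X → ℝ) →ₗ[ℝ] (X → ℝ)} {T' : (X' → ℝ) →ₗ[ℝ] (X' → ℝ)} {a b : X → ℝ} {a' b' : X' → ℝ} {Sc : Set g.Site} {ca cb oa ob β m δ : ℝ}
    (hca : 0 ≤ ca) (hcb : 0 ≤ cb) (hoa : 0 ≤ oa) (hβ : 0 ≤ β) (hm : 0 ≤ m) (ha' : ∀ x', |a' x'| ≤ ca) (hb : ∀ x, |b x| ≤ cb)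
    (hDa : HasMaj (BlockNorm.ofBlocks g blk) (BlockNorm.ofBlocks g (blk ∘ π)) (idef τ τ (mulOp a') (mulOp a)) (diagK fun _ => oa))
    (hDb : HasMaj (BlockNorm.ofBlocks g blk) (BlockNorm.ofBlocks g (blk ∘ π)) (idef τ τ (mulOp b') (mulOp b)) (diagK fun _ => ob))
    (hT : HasMaj (BlockNorm.ofBlocks g blk) (BlockNorm.ofBlocks g blk) T (fun y y' => ind Sc y * ind Sc y' * (β * Real.exp (-(δ * g.dist y y')))))
    (hT' : HasMaj (BlockNorm.ofBlocks g (blk ∘ π)) (BlockNorm.ofBlocks g (blk ∘ π)) T' (fun y y' => ind Sc y * ind Sc y' * (β * Real.exp (-(δ * g.dist y y')))))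
    (hDT : HasMaj (BlockNorm.ofBlocks g blk) (BlockNorm.ofBlocks g (blk ∘ π)) (idef τ τ T' T) (fun y y' => ind Sc y * ind Sc y' * (m * Real.exp (-(δ * g.dist y y'))))) :
    HasMaj (BlockNorm.ofBlocks g blk) (BlockNorm.ofBlocks g (blk ∘ π)) (idef τ τ (mulOp a' ∘ₗ T' ∘ₗ mulOp b') (mulOp a ∘ₗ T ∘ₗ mulOp b))
      (fun y y' => ind Sc y * ind Sc y' * ((ca * β * ob + ca * m * cb + oa * β * cb) * Real.exp (-(δ * g.dist y y')))) := by
  have hMa' := hasMaj_mulOp (g := g) (blk ∘ π) (m := fun _ => ca) (fun _ => hca) ha'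
  have hMb := hasMaj_mulOp (g := g) blk (m := fun _ => cb) (fun _ => hcb) hb
  have hnn : ∀ (c : ℝ), 0 ≤ c → ∀ y y' : g.Site, 0 ≤ ind Sc y * ind Sc y' * (c * Real.exp (-(δ * g.dist y y'))) :=
    fun c hc y y' => mul_nonneg (mul_nonneg (ind_nonneg _ _) (ind_nonneg _ _)) (mul_nonneg hc (Real.exp_nonneg _))
  have t1 := hasMaj_diag_comp (blk ∘ π) (fun _ => hca) hMa' (hasMaj_comp_diag (blk ∘ π) (hnn β hβ) hT' hDb)
  have t2 := hasMaj_diag_comp (blk ∘ π) (fun _ => hca) hMa' (hasMaj_comp_diag blk (hnn m hm) hDT hMb)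
  have t3 := hasMaj_diag_comp blk (fun _ => hoa) hDa (hasMaj_comp_diag blk (hnn β hβ) hT hMb)
  rw [idef_sandwich_tr τ]
  refine ((t1.add t2).add t3).mono fun y y' => le_of_eq ?_
  ring

end Sandwich

/-! ## §2 The left-dressed parametrix through a general transport -/

section Parametrix

variable {X X' : Type} [Fintype X] [Fintype X'] {ι : Type} [Fintype ι] {g : B6.Geometry} (blk : X → g.Site) (π : X' → X) (S : ι → Set g.Site)
  (τ : (X → ℝ) →ₗ[ℝ] (X' → ℝ))

/-- ★★ **THE η-DEFECT OF THE LEFT-DRESSED PARAMETRIX THROUGH `τ`** from the cubes' entry defects `𝔇_τ(D′G′_□, DG_□) ≤ 1·1·m₁e^{−δd}`, `𝔇_τ(G′_□, G_□) ≤ 1·1·m₀e^{−δd}`, the entries'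
majorants (`β₁`, `β` at both spacings), the fine partition letters (`|h^s′| ≤ c_s`, `|dh′| ≤ c_d`), `|h| ≤ 1` and the partition-defect ROWS (`o`, `o_s`, `o_d`):
`𝔇_τ(D′∘G₀′, D∘G₀) ≤ N_ov·[(c_sβ₁o + c_sm₁ + o_sβ₁) + (c_dβo + c_dm₀ + o_dβ)]·e^{−δd}` (FILE 47 `hasMaj_idef_comp_parametrix` with `pull π ↦ τ`).
[cite: Balaban1984PropagatorsII, (2.133), (2.136) p.247 (shapes); Balaban1985BackgroundPropagators, Thm 3.14 pp.426–427 (difference template)] -/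
theorem hasMaj_idef_comp_parametrix_tr {D : (X → ℝ) →ₗ[ℝ] (X → ℝ)} {D' : (X' → ℝ) →ₗ[ℝ] (X' → ℝ)} {h hs dh : ι → X → ℝ} {h' hs' dh' : ι → X' → ℝ}
    {G : ι → (X → ℝ) →ₗ[ℝ] (X → ℝ)} {G' : ι → (X' → ℝ) →ₗ[ℝ] (X' → ℝ)} {β β₁ cs cd o os od m₀ m₁ δ Nov : ℝ} (hβ : 0 ≤ β) (hβ₁ : 0 ≤ β₁) (hcs : 0 ≤ cs) (hcd : 0 ≤ cd)
    (ho : 0 ≤ o) (hos : 0 ≤ os) (hod : 0 ≤ od) (hm₀ : 0 ≤ m₀) (hm₁ : 0 ≤ m₁)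
    (hleib : ∀ i, D ∘ₗ mulOp (h i) = mulOp (hs i) ∘ₗ D + mulOp (dh i)) (hleib' : ∀ i, D' ∘ₗ mulOp (h' i) = mulOp (hs' i) ∘ₗ D' + mulOp (dh' i))
    (hh : ∀ i x, |h i x| ≤ 1) (hhs' : ∀ i x', |hs' i x'| ≤ cs) (hdh' : ∀ i x', |dh' i x'| ≤ cd)
    (hDh : ∀ i, HasMaj (BlockNorm.ofBlocks g blk) (BlockNorm.ofBlocks g (blk ∘ π)) (idef τ τ (mulOp (h' i)) (mulOp (h i))) (diagK fun _ => o))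
    (hDhs : ∀ i, HasMaj (BlockNorm.ofBlocks g blk) (BlockNorm.ofBlocks g (blk ∘ π)) (idef τ τ (mulOp (hs' i)) (mulOp (hs i))) (diagK fun _ => os))
    (hDdh : ∀ i, HasMaj (BlockNorm.ofBlocks g blk) (BlockNorm.ofBlocks g (blk ∘ π)) (idef τ τ (mulOp (dh' i)) (mulOp (dh i))) (diagK fun _ => od))
    (hN : ∀ a, ∑ i, ind (S i) a ≤ Nov)
    (hG : ∀ i, HasMaj (BlockNorm.ofBlocks g blk) (BlockNorm.ofBlocks g blk) (G i) (fun y y' => ind (S i) y * ind (S i) y' * (β * Real.exp (-(δ * g.dist y y')))))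
    (hG' : ∀ i, HasMaj (BlockNorm.ofBlocks g (blk ∘ π)) (BlockNorm.ofBlocks g (blk ∘ π)) (G' i)
      (fun y y' => ind (S i) y * ind (S i) y' * (β * Real.exp (-(δ * g.dist y y')))))
    (hDG : ∀ i, HasMaj (BlockNorm.ofBlocks g blk) (BlockNorm.ofBlocks g blk) (D ∘ₗ G i) (fun y y' => ind (S i) y * ind (S i) y' * (β₁ * Real.exp (-(δ * g.dist y y')))))
    (hDG' : ∀ i, HasMaj (BlockNorm.ofBlocks g (blk ∘ π)) (BlockNorm.ofBlocks g (blk ∘ π)) (D' ∘ₗ G' i)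
      (fun y y' => ind (S i) y * ind (S i) y' * (β₁ * Real.exp (-(δ * g.dist y y')))))
    (hIG : ∀ i, HasMaj (BlockNorm.ofBlocks g blk) (BlockNorm.ofBlocks g (blk ∘ π)) (idef τ τ (G' i) (G i))
      (fun y y' => ind (S i) y * ind (S i) y' * (m₀ * Real.exp (-(δ * g.dist y y')))))
    (hIDG : ∀ i, HasMaj (BlockNorm.ofBlocks g blk) (BlockNorm.ofBlocks g (blk ∘ π)) (idef τ τ (D' ∘ₗ G' i) (D ∘ₗ G i))
      (fun y y' => ind (S i) y * ind (S i) y' * (m₁ * Real.exp (-(δ * g.dist y y'))))) :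
    HasMaj (BlockNorm.ofBlocks g blk) (BlockNorm.ofBlocks g (blk ∘ π)) (idef τ τ (D' ∘ₗ parametrix h' G') (D ∘ₗ parametrix h G))
      (fun y y' => Nov * ((cs * β₁ * o + cs * m₁ * 1 + os * β₁ * 1) + (cd * β * o + cd * m₀ * 1 + od * β * 1)) * Real.exp (-(δ * g.dist y y'))) := by
  have hterm : ∀ i, HasMaj (BlockNorm.ofBlocks g blk) (BlockNorm.ofBlocks g (blk ∘ π))
      (idef τ τ (mulOp (hs' i) ∘ₗ (D' ∘ₗ G' i) ∘ₗ mulOp (h' i) + mulOp (dh' i) ∘ₗ G' i ∘ₗ mulOp (h' i))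
        (mulOp (hs i) ∘ₗ (D ∘ₗ G i) ∘ₗ mulOp (h i) + mulOp (dh i) ∘ₗ G i ∘ₗ mulOp (h i)))
      (fun y y' => ind (S i) y * (((cs * β₁ * o + cs * m₁ * 1 + os * β₁ * 1) + (cd * β * o + cd * m₀ * 1 + od * β * 1)) * Real.exp (-(δ * g.dist y y')))) := fun i => by
    have t1 := hasMaj_idef_sandwich_loc_tr blk π τ hcs zero_le_one hos hβ₁ hm₁ (hhs' i) (hh i) (hDhs i) (hDh i) (hDG i) (hDG' i) (hIDG i)
    have t2 := hasMaj_idef_sandwich_loc_tr blk π τ hcd zero_le_one hod hβ hm₀ (hdh' i) (hh i) (hDdh i) (hDh i) (hG i) (hG' i) (hIG i)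
    rw [idef_add]
    refine (t1.add t2).mono fun y y' => ?_
    have key := ind_mul_ind_le (Sc := S i) (A := ((cs * β₁ * o + cs * m₁ * 1 + os * β₁ * 1) + (cd * β * o + cd * m₀ * 1 + od * β * 1)) * Real.exp (-(δ * g.dist y y')))
      (mul_nonneg (by positivity) (Real.exp_nonneg _)) y y'
    calc ind (S i) y * ind (S i) y' * ((cs * β₁ * o + cs * m₁ * 1 + os * β₁ * 1) * Real.exp (-(δ * g.dist y y'))) +
          ind (S i) y * ind (S i) y' * ((cd * β * o + cd * m₀ * 1 + od * β * 1) * Real.exp (-(δ * g.dist y y')))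
        = ind (S i) y * ind (S i) y' * (((cs * β₁ * o + cs * m₁ * 1 + os * β₁ * 1) + (cd * β * o + cd * m₀ * 1 + od * β * 1)) * Real.exp (-(δ * g.dist y y'))) := by ring
      _ ≤ _ := key
  rw [comp_parametrix_of_leibniz hleib, comp_parametrix_of_leibniz hleib', idef_fsum_tr τ]
  refine (hasMaj_sum_overlap _ S _ Nov (fun y y' => mul_nonneg (by positivity) (Real.exp_nonneg _)) hterm hN).mono fun y y' => le_of_eq ?_
  ring

end Parametrix

/-! ## §3 The gradient entry of the glued operator with defects through a general transport -/

section Glued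

variable {X X' : Type} [Fintype X] [Fintype X'] [DecidableEq X] [DecidableEq X'] {ι : Type} [Fintype ι] {g : B6.Geometry} (blk : X → g.Site) (π : X' → X)
  (S : ι → Set g.Site) {σ cr : ℝ} (τ : (X → ℝ) →ₗ[ℝ] (X' → ℝ))

/-- ★★★ **THE TWO-GRID η-DEFECT OF `D∘𝒢` THROUGH A GENERAL TRANSPORT `τ`** — dag-n15-c g16 FILE 136 `hasMaj_idef_comp_glued_of_cutRows_defect` with `pull π ↦ τ`: the same data on both grids,
the Leibniz rule `D∘M_{h_□} = M_{h^s_□}∘D + M_{dh_□}` on both grids, the partition-defect ROWS `𝔇_τ(M_{h′}, M_h) ≤ diag o`, `𝔇_τ(M_{h^s′}, M_{h^s}) ≤ diag o_s`, `𝔇_τ(M_{dh′}, M_{dh}) ≤ diag o_d`,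
and the per-cube η-defects of the cut rows (`m₀`), of their gradient rows (`m₁`), of the remainder rows (`r`), of the defect rows (`r_E`) ⟹
`𝔇_τ(D′∘𝒢′, D∘𝒢) ≤ [A·((1−θc_r)⁻¹((1−θc_r)⁻¹ r̂ c_r)c_r)c_r + m̂(1−θc_r)⁻¹c_r]·e^{−(δ−2σ)d}` with `A = N_ov(c_sβ₁ + c_dβ)`, `θ = N_ov(θ₀+ε)`, `r̂ = N_ov(θ₀o + r + (εo + r_E))`,
`m̂ = N_ov[(c_sβ₁o + c_sm₁ + o_sβ₁) + (c_dβo + c_dm₀ + o_dβ)]`. [cite: Balaban1985BackgroundPropagators, Thm 3.14 pp.426–427 (difference template), (3.42) p.397 (gradient entries: shape); Balaban1984PropagatorsII, (2.91)–(2.92) p.239, (2.133)–(2.136) p.247; Balaban1985Averaging, (125) p.36 (transport: shape)] -/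
theorem hasMaj_idef_comp_glued_of_cutRows_defect_tr (htri : Triangle254 g) (hd : ∀ a b : g.Site, 0 ≤ g.dist a b) (hd0 : ∀ y : g.Site, g.dist y y = 0) (hrow : RowSum g σ cr)
    (hσ : 0 ≤ σ) (hcr : 0 ≤ cr) {Δ D : (X → ℝ) →ₗ[ℝ] (X → ℝ)} {Δ' D' : (X' → ℝ) →ₗ[ℝ] (X' → ℝ)} {h χ hs dh : ι → X → ℝ} {h' χ' hs' dh' : ι → X' → ℝ}
    {G E : ι → (X → ℝ) →ₗ[ℝ] (X → ℝ)} {G' E' : ι → (X' → ℝ) →ₗ[ℝ] (X' → ℝ)} {β β₁ cs cd o os od m₀ m₁ θ₀ ε r rE δ Nov : ℝ} (hβ : 0 ≤ β) (hβ₁ : 0 ≤ β₁) (hcs : 0 ≤ cs)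
    (hcd : 0 ≤ cd) (ho : 0 ≤ o) (hos : 0 ≤ os) (hod : 0 ≤ od) (hm₀ : 0 ≤ m₀) (hm₁ : 0 ≤ m₁) (hθ : 0 ≤ θ₀) (hε : 0 ≤ ε) (hr : 0 ≤ r) (hrE : 0 ≤ rE) (hNov : 0 ≤ Nov)
    (hσδ : 2 * σ ≤ δ)
    (hleib : ∀ i, D ∘ₗ mulOp (h i) = mulOp (hs i) ∘ₗ D + mulOp (dh i)) (hleib' : ∀ i, D' ∘ₗ mulOp (h' i) = mulOp (hs' i) ∘ₗ D' + mulOp (dh' i))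
    (hcut : ∀ i, mulOp (h i) ∘ₗ mulOp (χ i) = mulOp (h i)) (hcut' : ∀ i, mulOp (h' i) ∘ₗ mulOp (χ' i) = mulOp (h' i))
    (hh : ∀ i x, |h i x| ≤ 1) (hh' : ∀ i x', |h' i x'| ≤ 1) (hhs' : ∀ i x', |hs' i x'| ≤ cs) (hdh' : ∀ i x', |dh' i x'| ≤ cd)
    (hDh : ∀ i, HasMaj (BlockNorm.ofBlocks g blk) (BlockNorm.ofBlocks g (blk ∘ π)) (idef τ τ (mulOp (h' i)) (mulOp (h i))) (diagK fun _ => o))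
    (hDhs : ∀ i, HasMaj (BlockNorm.ofBlocks g blk) (BlockNorm.ofBlocks g (blk ∘ π)) (idef τ τ (mulOp (hs' i)) (mulOp (hs i))) (diagK fun _ => os))
    (hDdh : ∀ i, HasMaj (BlockNorm.ofBlocks g blk) (BlockNorm.ofBlocks g (blk ∘ π)) (idef τ τ (mulOp (dh' i)) (mulOp (dh i))) (diagK fun _ => od))
    (hN : ∀ b, ∑ i, ind (S i) b ≤ Nov)
    (hGc : ∀ i, HasMaj (BlockNorm.ofBlocks g blk) (BlockNorm.ofBlocks g blk) (mulOp (χ i) ∘ₗ G i) (fun y y' => ind (S i) y * ind (S i) y' * (β * Real.exp (-(δ * g.dist y y')))))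
    (hGc' : ∀ i, HasMaj (BlockNorm.ofBlocks g (blk ∘ π)) (BlockNorm.ofBlocks g (blk ∘ π)) (mulOp (χ' i) ∘ₗ G' i) (fun y y' => ind (S i) y * ind (S i) y' * (β * Real.exp (-(δ * g.dist y y')))))
    (hDGc : ∀ i, HasMaj (BlockNorm.ofBlocks g blk) (BlockNorm.ofBlocks g blk) (D ∘ₗ (mulOp (χ i) ∘ₗ G i)) (fun y y' => ind (S i) y * ind (S i) y' * (β₁ * Real.exp (-(δ * g.dist y y')))))
    (hDGc' : ∀ i, HasMaj (BlockNorm.ofBlocks g (blk ∘ π)) (BlockNorm.ofBlocks g (blk ∘ π)) (D' ∘ₗ (mulOp (χ' i) ∘ₗ G' i)) (fun y y' => ind (S i) y * ind (S i) y' * (β₁ * Real.exp (-(δ * g.dist y y')))))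
    (hIGc : ∀ i, HasMaj (BlockNorm.ofBlocks g blk) (BlockNorm.ofBlocks g (blk ∘ π)) (idef τ τ (mulOp (χ' i) ∘ₗ G' i) (mulOp (χ i) ∘ₗ G i))
      (fun y y' => ind (S i) y * ind (S i) y' * (m₀ * Real.exp (-(δ * g.dist y y')))))
    (hIDGc : ∀ i, HasMaj (BlockNorm.ofBlocks g blk) (BlockNorm.ofBlocks g (blk ∘ π)) (idef τ τ (D' ∘ₗ (mulOp (χ' i) ∘ₗ G' i)) (D ∘ₗ (mulOp (χ i) ∘ₗ G i)))
      (fun y y' => ind (S i) y * ind (S i) y' * (m₁ * Real.exp (-(δ * g.dist y y')))))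
    (hK : ∀ i, HasMaj (BlockNorm.ofBlocks g blk) (BlockNorm.ofBlocks g blk) (commOp Δ (h i) ∘ₗ G i) (fun y y' => ind (S i) y' * (θ₀ * Real.exp (-(δ * g.dist y y')))))
    (hK' : ∀ i, HasMaj (BlockNorm.ofBlocks g (blk ∘ π)) (BlockNorm.ofBlocks g (blk ∘ π)) (commOp Δ' (h' i) ∘ₗ G' i) (fun y y' => ind (S i) y' * (θ₀ * Real.exp (-(δ * g.dist y y')))))
    (hDK : ∀ i, HasMaj (BlockNorm.ofBlocks g blk) (BlockNorm.ofBlocks g (blk ∘ π)) (idef τ τ (commOp Δ' (h' i) ∘ₗ G' i) (commOp Δ (h i) ∘ₗ G i))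
      (fun y y' => ind (S i) y' * (r * Real.exp (-(δ * g.dist y y')))))
    (hE : ∀ i, HasMaj (BlockNorm.ofBlocks g blk) (BlockNorm.ofBlocks g blk) (E i) (fun y y' => ind (S i) y * (ε * Real.exp (-(δ * g.dist y y')))))
    (hE' : ∀ i, HasMaj (BlockNorm.ofBlocks g (blk ∘ π)) (BlockNorm.ofBlocks g (blk ∘ π)) (E' i) (fun y y' => ind (S i) y * (ε * Real.exp (-(δ * g.dist y y')))))
    (hDE : ∀ i, HasMaj (BlockNorm.ofBlocks g blk) (BlockNorm.ofBlocks g (blk ∘ π)) (idef τ τ (E' i) (E i)) (fun y y' => ind (S i) y * (rE * Real.exp (-(δ * g.dist y y')))))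
    (hq : Nov * (θ₀ + ε) * cr < 1) :
    HasMaj (BlockNorm.ofBlocks g blk) (BlockNorm.ofBlocks g (blk ∘ π))
      (idef τ τ (D' ∘ₗ glueInv (parametrix h' G') (remainder Δ' h' G' - ∑ i, E' i ∘ₗ mulOp (h' i)))
        (D ∘ₗ glueInv (parametrix h G) (remainder Δ h G - ∑ i, E i ∘ₗ mulOp (h i))))
      (fun y y' => (Nov * (cs * β₁ + cd * β) * ((1 - Nov * (θ₀ + ε) * cr)⁻¹ * ((1 - Nov * (θ₀ + ε) * cr)⁻¹ * (Nov * (θ₀ * o + r + (ε * o + rE))) * cr) * cr) * cr +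
        Nov * ((cs * β₁ * o + cs * m₁ * 1 + os * β₁ * 1) + (cd * β * o + cd * m₀ * 1 + od * β * 1)) * (1 - Nov * (θ₀ + ε) * cr)⁻¹ * cr) * Real.exp (-((δ - 2 * σ) * g.dist y y'))) := by
  have hP' := hasMaj_comp_parametrix (blk ∘ π) S hβ hβ₁ hcs hcd hleib' hh' hhs' hdh' hN hGc' hDGc'
  have hIP := hasMaj_idef_comp_parametrix_tr blk π S τ hβ hβ₁ hcs hcd ho hos hod hm₀ hm₁ hleib hleib' hh hhs' hdh' hDh hDhs hDdh hN hGc hGc' hDGc hDGc' hIGc hIDGc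
  rw [parametrix_cut hcut'] at hP'
  rw [parametrix_cut hcut, parametrix_cut hcut'] at hIP
  rw [comp_glueInv, comp_glueInv]
  exact hasMaj_idef_glueInv_tr blk π τ htri hd hd0 hrow hσ hcr (by positivity) (mul_nonneg hNov (add_nonneg hθ hε)) (by positivity) (by positivity) hσδ hP'
    (hasMaj_remainderD blk S hθ hε hh hN hK hE) (hasMaj_remainderD (blk ∘ π) S hθ hε hh' hN hK' hE') hIP
    (hasMaj_idef_remainderD_tr blk π S τ hθ hr hε hrE ho hh hDh hN hK' hDK hE' hDE) hq

end Glued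

end Summit.QuantumFields.YangMills.BalabanUVNodes.N15.Gluing

end
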